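import Literature.NumberTheory.EllipticCurves.LangHeightSmallPointsProofs
import Literature.NumberTheory.EllipticCurves.LangHeightNonarchEstimateProofs
import Literature.NumberTheory.EllipticCurves.NeronLocalHeightDecompositionProofs
import HarnessLib

/-!
# Szpiro ⇒ Lang's height lower bound over `ℚ`: the current frontier of the formal proof

Topic `NumberTheory/EllipticCurves` (family `abc`, G06). This file assembles the proved layers of
the decomposition of the named fact
`Literature.NumberTheory.EllipticCurves.szpiro_imp_langHeightLowerBoundConjecture` ("Szpiro's
conjecture implies Lang's height lower bound conjecture over `ℚ`"; Hindry–Silverman, Invent. Math.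
93 (1988), Thm. 0.3 with the remark after Conj. 0.4; Silverman, AEC 2nd ed., Thm. VIII.9.10(b);
proved in print along Petsche, New York J. Math. 12 (2006), Thm. 2 / Prop. 7) into a single
conditional theorem, `szpiro_imp_langHeightLowerBoundConjecture_of_localHeightTheory`, whose
hypotheses are exactly the remaining named facts of Néron local height theory:

1. `Petsche2006_lemma3` — Petsche 2006, Lemma 3 (a variant of Hindry–Silverman, *On Lehmer's
   conjecture for elliptic curves*, Prop. 1.2): the non-archimedean local average bound
   `Λ_v(Z) ≥ (1/c_v² − 1/N)(1/12) log|1/Δ_v|_v`, resting on Tate's uniformisation;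
2. the Kodaira–Néron theorem in the form of the tree's facts
   `WeierstrassCurve.index_goodReductionSubgroup_le_four` and
   `WeierstrassCurve.index_goodReductionSubgroup_of_hasSplitMultiplicativeReduction`
   (`KodairaNeron.lean`; Silverman ATAEC Cor. IV.9.2(d), AEC Thm. VII.6.1), at the local minimal
   models of `W` over the completions `ℚ_v`;
3. `Petsche2006_exists_subset_le_neronLocalHeight_real` — the archimedean step of Petsche's proof of
   Prop. 7 (pigeonhole on the `24²` parallelograms of `ℂ/L` and Hindry–Silverman's Lemma 5,
   resting on the complex uniformisation and the explicit formula for `λ_∞`).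

Everything else in the printed chain is proved in the tree: Tate's Lemma VI.1.2
(`NeronLocalHeightTateLemma`), `λ_v = λ₁,v` at good places (`NeronLocalHeightGoodPlaces`), the local
decomposition ATAEC VI.2.1 (`NeronLocalHeightDecompositionProofs`), Petsche's non-archimedean
estimate with Jensen's inequality (`LangHeightNonarchEstimateProofs`), Proposition 7 and Theorem 2
over `ℚ` (`LangHeightSmallPointsProofs`, `LangHeightECProofs`), and the passage from Szpiro's
conjecture to a bounded Szpiro ratio (`LangHeightECProofs`).

## References

* M. Hindry, J. H. Silverman, *The canonical height and integral points on elliptic curves*,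
  Invent. Math. 93 (1988), 419–450, Thm. 0.3.
* C. Petsche, *Small rational points on elliptic curves over number fields*, New York J. Math. 12
  (2006), 257–268, Lemma 3, Prop. 7, Thm. 2.
* J. H. Silverman, *Advanced Topics in the Arithmetic of Elliptic Curves* (1994), IV.9, VI.1–VI.4;
  *The Arithmetic of Elliptic Curves*, 2nd ed. (2009), VII.6.1, VIII.9.10(b).
-/

noncomputable section

open scoped Classical

open IsDedekindDomain

namespace Literature.NumberTheory.EllipticCurves

open _root_.WeierstrassCurve _root_.WeierstrassCurve.Affine.Point

/-- **Szpiro ⇒ Lang over `ℚ`, conditional on the local height theory only**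
(`szpiro_imp_langHeightLowerBoundConjecture`; Hindry–Silverman 1988, Thm. 0.3): from Petsche's
Lemma 3 (`h3`), the Kodaira–Néron facts of `KodairaNeron.lean` at the local minimal models
(`h4`, `hsplit`) and the archimedean step (`hb`). The local decomposition of the canonical height
(ATAEC VI.2.1) is no longer a hypothesis: it is `canonicalHeight_eq_two_mul_sum_neronLocalHeight_holds`.
[cite: HindrySilverman1988, Thm 0.3] -/
theorem szpiro_imp_langHeightLowerBoundConjecture_of_localHeightTheory
    (h3 : Petsche2006_lemma3)
    (h4 : ∀ (W : WeierstrassCurve ℚ) (v : HeightOneSpectrum ℤ),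
      (W.localMinimalModel v).index_goodReductionSubgroup_le_four (v.adicCompletionIntegers ℚ))
    (hsplit : ∀ (W : WeierstrassCurve ℚ) (v : HeightOneSpectrum ℤ),
      (W.localMinimalModel v).index_goodReductionSubgroup_of_hasSplitMultiplicativeReduction
        (v.adicCompletionIntegers ℚ))
    (hb : Petsche2006_exists_subset_le_neronLocalHeight_real) :
    szpiro_imp_langHeightLowerBoundConjecture :=
  szpiro_imp_langHeightLowerBoundConjecture_of_local
    (Petsche2006_le_finsum_localHeightDiscSum_of h3 h4 hsplit
      canonicalHeight_eq_two_mul_sum_neronLocalHeight_holds)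
    hb canonicalHeight_eq_two_mul_sum_neronLocalHeight_holds

/-- **Petsche 2006, Proposition 7 over `ℚ`, conditional on the local height theory only** (same
hypotheses as `szpiro_imp_langHeightLowerBoundConjecture_of_localHeightTheory`).
[cite: Petsche2006, Prop. 7] -/
theorem Petsche2006_card_smallPoints_le_of_localHeightTheory
    (h3 : Petsche2006_lemma3)
    (h4 : ∀ (W : WeierstrassCurve ℚ) (v : HeightOneSpectrum ℤ),
      (W.localMinimalModel v).index_goodReductionSubgroup_le_four (v.adicCompletionIntegers ℚ))
    (hsplit : ∀ (W : WeierstrassCurve ℚ) (v : HeightOneSpectrum ℤ),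
      (W.localMinimalModel v).index_goodReductionSubgroup_of_hasSplitMultiplicativeReduction
        (v.adicCompletionIntegers ℚ))
    (hb : Petsche2006_exists_subset_le_neronLocalHeight_real) :
    Petsche2006_card_smallPoints_le :=
  Petsche2006_card_smallPoints_le_of
    (Petsche2006_le_finsum_localHeightDiscSum_of h3 h4 hsplit
      canonicalHeight_eq_two_mul_sum_neronLocalHeight_holds)
    hb canonicalHeight_eq_two_mul_sum_neronLocalHeight_holds

end Literature.NumberTheory.EllipticCurves

end
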